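import Summits.QuantumFields.QCD.Theorems.QuarksAsStableActionStableActionBridgeStubSpectralTraceC
import Literature.Analysis.OperatorTheory.HermitianKernelSpectralTrace
import HarnessLib

/-!
# Stub `stub_spectralTraceInsertC` of line `twisted_trace_transfer` for crux `QuarksAsStableAction.StableActionBridge`
# (stmt-QuantumFields-9737): spectral trace formulas with one and two BOND insertions, complex Hermitian kernels

This is the registered stub `stub_spectralTraceInsertC` (sub-goal E1a of the line skeleton `twisted_trace_transfer` for
the crux `Summit.QuantumFields.QCD.Theses.QuarksAsStableAction.StableActionBridge`, item stmt-QuantumFields-9737): the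
complex Hermitian port of the tree's REAL `Literature.Analysis.OperatorTheory.hasSum_integral_iterate_insert_one`
(`PositiveKernelSpectralTrace.lean`) and `hasSum_integral_iterate_insert_two` (`PositiveKernelSpectralTraceTwo.lean`),
WITHOUT a sign hypothesis on the eigenvalues.

Setting: `(Y, ρ)` a finite measure space; `K : Y → Y → ℂ` strongly measurable, bounded and Hermitian
(`K(x,y) = conj K(y,x)`); `A` a bounded operator on `L²(ρ; ℂ) = Lp ℂ 2 ρ` with the a.e. kernel formula; `b` a countable
Hilbert basis of eigenvectors, `A bᵢ = λᵢ bᵢ`, `λᵢ ∈ ℝ`; two bounded strongly measurable bond kernels `X, X'` with `L²`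
operators `𝒳, 𝒳'` (a.e. kernel formulas); `κ f = ∫ K(·,z) f(z) dρ(z)` the POINTWISE kernel operator.  Claims
(`Tr(𝒳 A^{M+2})` and `Tr(𝒳 A^{a+2} 𝒳' A^{b+2})` without a trace class):
* `∫∫ X(x,y) (κ^[M+1] K(·,x))(y) dρ(y) dρ(x) = Σᵢ λᵢ^{M+2} ⟪bᵢ, 𝒳 bᵢ⟫`;
* `∫∫ X(x,y) (κ^[a+2] (z ↦ ∫ X'(z,v) (κ^[b+1] K(·,x))(v)))(y) = Σ_{(i,j)} λⱼ^{a+2} λᵢ^{b+2} ⟪bᵢ, 𝒳 bⱼ⟫ ⟪bⱼ, 𝒳' bᵢ⟫`.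

Proof (sub-namespace `StubSpectralTraceInsertC`; Mathlib's inner product is conjugate-linear in the FIRST slot, so the
`L²` section of a kernel `X` at `x` is `t_x = conj X(x,·)` with `⟪t_x, φ⟫ = ∫ X(x,y) φ(y)`, and Hermiticity of `K` reads
`K(·,x) = s_x := conj K(x,·)`):
* the INNER integral is an honest inner product (`integral_mul_iterate_eq_inner`, from `A^j [h] =ᵐ κ^[j] h` of the
  sibling file `…StubSpectralTraceC`): `∫ X(x,y) (κ^[M+1] s_x)(y) dy = ⟪t_x, A^{M+1} s_x⟫`, and for two insertions
  `∫ X(x,y) (κ^[a+2] F_x)(y) dy = ⟪t_x, T s_x⟫` with `T = A^{a+2} 𝒳' A^{b+1}` because the class of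
  `F_x = ∫ X'(·,v) (κ^[b+1] s_x)(v)` is `𝒳' A^{b+1} s_x` (`exists_toLp_integral_mul_iterate`) — this replaces the first
  dominated-convergence level of the real files;
* Parseval in the eigenbasis (self-adjointness, real eigenvalues): `⟪t_x, A^{M+1} s_x⟫ = Σᵢ dᵢ(x) λᵢ^{M+1} conj cᵢ(x)`
  with `cᵢ(x) = ∫ K(x,z) bᵢ(z) = ⟪s_x, bᵢ⟫`, `dᵢ(x) = ∫ X(x,y) bᵢ(y) = ⟪t_x, bᵢ⟫`; and the double Parseval identity
  `⟪t_x, T s_x⟫ = Σ_{(i,j)} conj cᵢ(x) dⱼ(x) ⟪bⱼ, T bᵢ⟫` (`hasSum_inner_apply_prod`, valid once the double family is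
  summable), `⟪bⱼ, T bᵢ⟫ = λⱼ^{a+2} λᵢ^{b+1} ⟪bⱼ, 𝒳' bᵢ⟫`;
* ONE dominated convergence in `x` (`hasSum_integral_of_dominated_convergence`) with the dominants
  `‖A‖^M · CX √ρ(Y) · (|cᵢ(x)|² + λᵢ²)/2`, resp. `const · (|cᵢ(x)|² + λᵢ²)/2 · λⱼ²`, using `|λᵢ| ≤ ‖A‖`,
  `|dⱼ(x)| ≤ CX √ρ(Y)`, Bessel–Parseval `Σᵢ |cᵢ(x)|² = ∫ |K(x,·)|² ≤ C² ρ(Y)` and Hilbert–Schmidt `Σᵢ λᵢ² = ∬ |K|² < ∞`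
  (`hasSum_lam_sq`) — no sign condition on `λᵢ`;
* the terms: `cᵢ =ᵐ λᵢ bᵢ` and `⟪bᵢ, 𝒳 bⱼ⟫ = ∫ conj bᵢ(x) ∫ X(x,y) bⱼ(y)` (`inner_eq_integral_of_ae_kernel`).

Mathlib + `HermitianKernelSpectralTrace` / `HermitianKernelOperator` / `IntegralOperatorHilbertSchmidt` + the sibling stub
file only; theorems only, no definitions.  References: B. Simon, *Trace Ideals and Their Applications* (2005), Ch. 3
(Thm. 3.1); M. Reed, B. Simon, *Methods of Modern Mathematical Physics I* (1980), §VI.6, Thm. VI.22–VI.23. [folklore]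
-/

noncomputable section

open MeasureTheory Filter Set Function
open scoped InnerProductSpace ComplexConjugate Matrix BigOperators ENNReal

namespace Summit.QuantumFields.QCD.Cruxes.StableActionBridge.TwistedTraceTransfer

namespace StubSpectralTraceInsertC

open Literature.Analysis.OperatorTheory

variable {Y : Type*} [MeasurableSpace Y] {ρ : Measure Y} [IsFiniteMeasure ρ]
  {K : Y → Y → ℂ} {C : ℝ} {A : Lp ℂ 2 ρ →L[ℂ] Lp ℂ 2 ρ} {ι : Type*}
  {b : HilbertBasis ι ℂ (Lp ℂ 2 ρ)} {lam : ι → ℝ}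
  {Xk : Y → Y → ℂ} {CX : ℝ} {Xop : Lp ℂ 2 ρ →L[ℂ] Lp ℂ 2 ρ}

/-! ### Bookkeeping -/

/-- **`Σᵢ λᵢ² = ∬ |K|²`** (Hilbert–Schmidt, `hasSum_norm_toLp_integral_kernel_mul_sq`): the real eigenvalues of the
eigenbasis are square summable. [folklore] -/
theorem hasSum_lam_sq [Countable ι] (hK : StronglyMeasurable (uncurry K)) (hC : ∀ x y, ‖K x y‖ ≤ C)
    (hA : ∀ φ : Lp ℂ 2 ρ, (A φ : Y → ℂ) =ᵐ[ρ] fun x => ∫ y, K x y * φ y ∂ρ)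
    (hb : ∀ i, A (b i) = (lam i : ℂ) • (b i : Lp ℂ 2 ρ)) :
    HasSum (fun i => lam i ^ 2) (∫ x, ∫ y, ‖K x y‖ ^ 2 ∂ρ ∂ρ) := by
  refine (hasSum_norm_toLp_integral_kernel_mul_sq (𝕜 := ℂ) hK hC b).congr_fun fun i => ?_
  have h1 : A (b i) = (memLp_two_integral_kernel_mul hK hC (b i : Lp ℂ 2 ρ)).toLp _ :=
    Lp.ext ((hA (b i)).trans (memLp_two_integral_kernel_mul hK hC (b i : Lp ℂ 2 ρ)).coeFn_toLp.symm)
  rw [← h1, hb, norm_smul, Complex.norm_real, Real.norm_eq_abs, b.orthonormal.norm_eq_one i, mul_one, sq_abs]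

/-- `x ↦ ∫ ‖K(x,·)‖² dρ` is integrable (bounded by `C² ρ(Y)` and measurable). [folklore] -/
theorem integrable_integral_norm_sq (hK : StronglyMeasurable (uncurry K)) (hC : ∀ x y, ‖K x y‖ ≤ C) :
    Integrable (fun x => ∫ z, ‖K x z‖ ^ 2 ∂ρ) ρ :=
  Integrable.of_bound (stronglyMeasurable_integral_norm_kernel_sq hK).aestronglyMeasurable (C ^ 2 * ρ.real univ)
    (Eventually.of_forall fun x => by
      rw [Real.norm_of_nonneg (integral_nonneg fun z => by positivity)]
      exact StubSpectralTraceC.integral_norm_kernel_sq_le hC x)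

/-! ### The inner integral as an inner product -/

/-- **`∫ X(x,y) (κ^[j] h)(y) dρ(y) = ⟪t_x, A^j [h]⟫`** for every `x`, with `t_x = conj X(x,·)` the `L²` section of the
bond kernel (`A^j [h] =ᵐ κ^[j] h` and `integral_kernel_mul_eq_inner`). [folklore] -/
theorem integral_mul_iterate_eq_inner (hX : StronglyMeasurable (uncurry Xk)) (hCX : ∀ x y, ‖Xk x y‖ ≤ CX)
    (hA : ∀ φ : Lp ℂ 2 ρ, (A φ : Y → ℂ) =ᵐ[ρ] fun x => ∫ y, K x y * φ y ∂ρ)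
    {h : Y → ℂ} (hh : MemLp h 2 ρ) (j : ℕ) (x : Y) :
    ∫ y, Xk x y * ((fun f : Y → ℂ => fun w => ∫ z, K w z * f z ∂ρ)^[j] h) y ∂ρ =
      ⟪(memLp_two_conj_kernel_section hX hCX x).toLp _, (A ^ j) (hh.toLp h)⟫_ℂ := by
  rw [← integral_kernel_mul_eq_inner hX hCX x]
  refine integral_congr_ae ?_
  filter_upwards [StubSpectralTraceC.pow_toLp_ae_eq_iterate hA hh j] with y hy
  rw [hy]

/-- **The class of `z ↦ ∫ X'(z,v) (κ^[j] h)(v) dρ(v)` is `𝒳' (A^j [h])`** (and it is in `ℒ²`). [folklore] -/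
theorem exists_toLp_integral_mul_iterate {Xk' : Y → Y → ℂ} {CX' : ℝ} {Xop' : Lp ℂ 2 ρ →L[ℂ] Lp ℂ 2 ρ}
    (hX' : StronglyMeasurable (uncurry Xk')) (hCX' : ∀ x y, ‖Xk' x y‖ ≤ CX')
    (hXop' : ∀ φ : Lp ℂ 2 ρ, (Xop' φ : Y → ℂ) =ᵐ[ρ] fun x => ∫ y, Xk' x y * φ y ∂ρ)
    (hA : ∀ φ : Lp ℂ 2 ρ, (A φ : Y → ℂ) =ᵐ[ρ] fun x => ∫ y, K x y * φ y ∂ρ)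
    {h : Y → ℂ} (hh : MemLp h 2 ρ) (j : ℕ) :
    ∃ hF : MemLp (fun z => ∫ v, Xk' z v * ((fun f : Y → ℂ => fun w => ∫ z, K w z * f z ∂ρ)^[j] h) v ∂ρ) 2 ρ,
      hF.toLp _ = Xop' ((A ^ j) (hh.toLp h)) := by
  have hFeq : (fun z => ∫ v, Xk' z v * ((fun f : Y → ℂ => fun w => ∫ z, K w z * f z ∂ρ)^[j] h) v ∂ρ) =
      fun z => ∫ v, Xk' z v * ((A ^ j) (hh.toLp h) : Y → ℂ) v ∂ρ := by
    funext z
    refine integral_congr_ae ?_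
    filter_upwards [StubSpectralTraceC.pow_toLp_ae_eq_iterate hA hh j] with v hv
    rw [hv]
  rw [hFeq]
  exact ⟨memLp_two_integral_kernel_mul hX' hCX' _, Lp.ext ((MemLp.coeFn_toLp _).trans (hXop' _).symm)⟩

/-- **Double Parseval through a bounded operator** (complex Hilbert space): for a Hilbert basis `(bᵢ)`, a bounded `T`
and vectors `v, w`, `⟪w, T v⟫ = Σ_{(i,j)} ⟪bᵢ, v⟫ ⟪w, bⱼ⟫ ⟪bⱼ, T bᵢ⟫` as a sum over `ι × ι`, PROVIDED the double
family is summable (expansion of `v`, continuity of `T` and `⟪w, ·⟫`, Parseval for `T bᵢ`, `HasSum.prod_fiberwise`).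
[folklore] -/
theorem hasSum_inner_apply_prod {E : Type*} [NormedAddCommGroup E] [InnerProductSpace ℂ E] {ι' : Type*}
    (b : HilbertBasis ι' ℂ E) (T : E →L[ℂ] E) (v w : E)
    (hs : Summable fun p : ι' × ι' => ⟪b p.1, v⟫_ℂ * (⟪w, b p.2⟫_ℂ * ⟪b p.2, T (b p.1)⟫_ℂ)) :
    HasSum (fun p : ι' × ι' => ⟪b p.1, v⟫_ℂ * (⟪w, b p.2⟫_ℂ * ⟪b p.2, T (b p.1)⟫_ℂ)) ⟪w, T v⟫_ℂ := by
  have hv : HasSum (fun i => ⟪b i, v⟫_ℂ • b i) v := by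
    simpa only [HilbertBasis.repr_apply_apply] using b.hasSum_repr v
  have hTv : HasSum (fun i => ⟪b i, v⟫_ℂ • T (b i)) (T v) := by
    simpa only [map_smul] using hv.mapL T
  have hg : HasSum (fun i => ⟪b i, v⟫_ℂ * ⟪w, T (b i)⟫_ℂ) ⟪w, T v⟫_ℂ := by
    simpa only [innerSL_apply_apply, inner_smul_right] using hTv.mapL (innerSL ℂ w)
  have h2 := hs.hasSum.prod_fiberwise fun i => (b.hasSum_inner_mul_inner w (T (b i))).mul_left ⟪b i, v⟫_ℂ
  rw [hg.unique h2]
  exact hs.hasSum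

/-! ### One bond insertion -/

/-- **One bond insertion.**  `∫∫ X(x,y) (κ^[M+1] K(·,x))(y) dρ(y) dρ(x) = Σᵢ λᵢ^{M+2} ⟪bᵢ, 𝒳 bᵢ⟫` (`Tr(𝒳 A^{M+2})`
without a trace class; no sign condition on the eigenvalues). [folklore] -/
theorem hasSum_insert_one [Countable ι] (hK : StronglyMeasurable (uncurry K)) (hC : ∀ x y, ‖K x y‖ ≤ C)
    (hherm : ∀ x y, K x y = conj (K y x))
    (hA : ∀ φ : Lp ℂ 2 ρ, (A φ : Y → ℂ) =ᵐ[ρ] fun x => ∫ y, K x y * φ y ∂ρ)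
    (hb : ∀ i, A (b i) = (lam i : ℂ) • (b i : Lp ℂ 2 ρ))
    (hX : StronglyMeasurable (uncurry Xk)) (hCX : ∀ x y, ‖Xk x y‖ ≤ CX)
    (hXop : ∀ φ : Lp ℂ 2 ρ, (Xop φ : Y → ℂ) =ᵐ[ρ] fun x => ∫ y, Xk x y * φ y ∂ρ) (M : ℕ) :
    HasSum (fun i => (lam i : ℂ) ^ (M + 2) * ⟪(b i : Lp ℂ 2 ρ), Xop (b i)⟫_ℂ)
      (∫ x, ∫ y, Xk x y * ((fun f : Y → ℂ => fun w => ∫ z, K w z * f z ∂ρ)^[M + 1] (fun z => K z x)) y ∂ρ ∂ρ) := by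
  -- notation: `c i x = (κ bᵢ)(x) = ⟪s_x, bᵢ⟫`, `d i x = ∫ X(x,y) bᵢ(y) = ⟪t_x, bᵢ⟫`
  set κ : (Y → ℂ) → Y → ℂ := fun f w => ∫ z, K w z * f z ∂ρ
  set c : ι → Y → ℂ := fun i x => ∫ z, K x z * (b i : Lp ℂ 2 ρ) z ∂ρ with hc
  set d : ι → Y → ℂ := fun i x => ∫ y, Xk x y * (b i : Lp ℂ 2 ρ) y ∂ρ with hd
  have hsec : ∀ x, (fun z => K z x) = fun z => conj (K x z) := fun x => funext fun z => hherm z x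
  have hsa : IsSelfAdjoint A := isSelfAdjoint_of_ae_hermitianKernel hK hC hherm hA
  have hcm : ∀ i, Measurable (c i) := fun i => (stronglyMeasurable_integral_kernel_mul hK (b i)).measurable
  have hdm : ∀ i, Measurable (d i) := fun i => (stronglyMeasurable_integral_kernel_mul hX (b i)).measurable
  have hlamA : ∀ i, |lam i| ≤ ‖A‖ := StubSpectralTraceC.abs_lam_le_norm hb
  have hlam2 : Summable fun i => lam i ^ 2 := (hasSum_lam_sq hK hC hA hb).summable
  have hpars := fun x => tsum_norm_sq_integral_kernel_mul_le (μ := ρ) hK hC b x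
  have hdb : ∀ i x, ‖d i x‖ ≤ CX * Real.sqrt (ρ.real univ) := fun i x => by
    have h := norm_integral_kernel_mul_le_sqrt hCX ((norm_nonneg _).trans (hCX x x)) (b i : Lp ℂ 2 ρ) x
    rwa [b.orthonormal.norm_eq_one i, mul_one] at h
  -- (1) pointwise expansion of the inner integral: `∫ X(x,y) (κ^[M+1] s_x)(y) dy = Σᵢ dᵢ(x) λᵢ^{M+1} conj cᵢ(x)`
  have hpt : ∀ x, HasSum (fun i => d i x * ((lam i : ℂ) ^ (M + 1) * conj (c i x)))
      (∫ y, Xk x y * (κ^[M + 1] (fun z => K z x)) y ∂ρ) := fun x => by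
    rw [hsec x, integral_mul_iterate_eq_inner hX hCX hA (memLp_two_conj_kernel_section hK hC x) (M + 1) x]
    refine ((b.hasSum_inner_mul_inner _ _)).congr_fun fun i => ?_
    rw [StubSpectralTraceC.inner_basis_pow_apply hsa hb (M + 1) i, ← inner_conj_symm (b i : Lp ℂ 2 ρ),
      ← integral_kernel_mul_eq_inner hK hC x (b i), ← integral_kernel_mul_eq_inner hX hCX x (b i)]
  -- (2) dominated convergence in `x`
  have key := hasSum_integral_of_dominated_convergence (μ := ρ)
    (F := fun i x => d i x * ((lam i : ℂ) ^ (M + 1) * conj (c i x)))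
    (f := fun x => ∫ y, Xk x y * (κ^[M + 1] (fun z => K z x)) y ∂ρ)
    (fun i x => ‖A‖ ^ M * (CX * Real.sqrt (ρ.real univ)) * ((‖c i x‖ ^ 2 + lam i ^ 2) / 2))
    (fun i => ((hdm i).mul ((Complex.continuous_conj.measurable.comp (hcm i)).const_mul _)).aestronglyMeasurable)
    (fun i => ?_) (Eventually.of_forall fun x => (((hpars x).1.add hlam2).div_const 2).mul_left _) ?_
    (Eventually.of_forall hpt)
  · -- (3) the terms: `∫ dᵢ λᵢ^{M+1} conj cᵢ = λᵢ^{M+2} ⟪bᵢ, 𝒳 bᵢ⟫`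
    refine key.congr_fun fun i => ?_
    rw [inner_eq_integral_of_ae_kernel hXop, ← integral_const_mul]
    refine integral_congr_ae ?_
    filter_upwards [StubSpectralTraceC.integral_kernel_mul_basis_ae_eq hA hb i] with x hx
    simp only [hc, hd]
    rw [hx, map_mul, Complex.conj_ofReal]
    ring
  · -- the domination `|dᵢ λᵢ^{M+1} cᵢ| ≤ ‖A‖^M CX √ρ(Y) (|cᵢ|² + λᵢ²)/2`
    refine Eventually.of_forall fun x => ?_
    have hCX0 : 0 ≤ CX * Real.sqrt (ρ.real univ) := (norm_nonneg _).trans (hdb i x)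
    have h1 : |lam i| ^ (M + 1) * ‖c i x‖ ≤ ‖A‖ ^ M * |lam i| * ‖c i x‖ := by
      rw [pow_succ]
      exact mul_le_mul_of_nonneg_right (mul_le_mul_of_nonneg_right (pow_le_pow_left₀ (abs_nonneg _) (hlamA i) M)
        (abs_nonneg _)) (norm_nonneg _)
    have h2 : ‖c i x‖ * |lam i| ≤ (‖c i x‖ ^ 2 + lam i ^ 2) / 2 := by
      nlinarith [sq_nonneg (‖c i x‖ - |lam i|), sq_abs (lam i)]
    calc ‖d i x * ((lam i : ℂ) ^ (M + 1) * conj (c i x))‖ = ‖d i x‖ * (|lam i| ^ (M + 1) * ‖c i x‖) := by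
          rw [norm_mul, norm_mul, norm_pow, Complex.norm_real, Real.norm_eq_abs, Complex.norm_conj]
      _ ≤ CX * Real.sqrt (ρ.real univ) * (‖A‖ ^ M * |lam i| * ‖c i x‖) :=
          mul_le_mul (hdb i x) h1 (by positivity) hCX0
      _ = ‖A‖ ^ M * (CX * Real.sqrt (ρ.real univ)) * (‖c i x‖ * |lam i|) := by ring
      _ ≤ ‖A‖ ^ M * (CX * Real.sqrt (ρ.real univ)) * ((‖c i x‖ ^ 2 + lam i ^ 2) / 2) :=
          mul_le_mul_of_nonneg_left h2 (mul_nonneg (by positivity) hCX0)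
  · -- integrability of the sum of the dominants `‖A‖^M CX √ρ(Y) (∫ |K(x,·)|² + Σ λ²)/2`
    have hfun : (fun x => ∑' i, ‖A‖ ^ M * (CX * Real.sqrt (ρ.real univ)) * ((‖c i x‖ ^ 2 + lam i ^ 2) / 2)) =
        fun x => ‖A‖ ^ M * (CX * Real.sqrt (ρ.real univ)) * ((∫ z, ‖K x z‖ ^ 2 ∂ρ + ∑' i, lam i ^ 2) / 2) := by
      funext x
      rw [tsum_mul_left, tsum_div_const, (hpars x).1.tsum_add hlam2, (hpars x).2.1]
    rw [hfun]
    exact (((integrable_integral_norm_sq hK hC).add (integrable_const _)).div_const 2).const_mul _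

/-! ### Two bond insertions -/

/-- **Two bond insertions.**  For two bounded bond kernels `X, X'` with `L²` operators `𝒳, 𝒳'`:
`∫∫ X(x,y) (κ^[a+2] (z ↦ ∫ X'(z,v) (κ^[b+1] K(·,x))(v)))(y) dρ(y) dρ(x)
   = Σ_{(i,j)} λⱼ^{a+2} λᵢ^{b+2} ⟪bᵢ, 𝒳 bⱼ⟫ ⟪bⱼ, 𝒳' bᵢ⟫` (`Tr(𝒳 A^{a+2} 𝒳' A^{b+2})`; no sign condition). [folklore] -/
theorem hasSum_insert_two [Countable ι] (hK : StronglyMeasurable (uncurry K)) (hC : ∀ x y, ‖K x y‖ ≤ C)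
    (hherm : ∀ x y, K x y = conj (K y x))
    (hA : ∀ φ : Lp ℂ 2 ρ, (A φ : Y → ℂ) =ᵐ[ρ] fun x => ∫ y, K x y * φ y ∂ρ)
    (hb : ∀ i, A (b i) = (lam i : ℂ) • (b i : Lp ℂ 2 ρ))
    (hX : StronglyMeasurable (uncurry Xk)) (hCX : ∀ x y, ‖Xk x y‖ ≤ CX)
    (hXop : ∀ φ : Lp ℂ 2 ρ, (Xop φ : Y → ℂ) =ᵐ[ρ] fun x => ∫ y, Xk x y * φ y ∂ρ)
    {Xk' : Y → Y → ℂ} {CX' : ℝ} (hX' : StronglyMeasurable (uncurry Xk')) (hCX' : ∀ x y, ‖Xk' x y‖ ≤ CX')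
    {Xop' : Lp ℂ 2 ρ →L[ℂ] Lp ℂ 2 ρ} (hXop' : ∀ φ : Lp ℂ 2 ρ, (Xop' φ : Y → ℂ) =ᵐ[ρ] fun x => ∫ y, Xk' x y * φ y ∂ρ)
    (a b' : ℕ) :
    HasSum (fun p : ι × ι => (lam p.2 : ℂ) ^ (a + 2) * (lam p.1 : ℂ) ^ (b' + 2) *
        ⟪(b p.1 : Lp ℂ 2 ρ), Xop (b p.2)⟫_ℂ * ⟪(b p.2 : Lp ℂ 2 ρ), Xop' (b p.1)⟫_ℂ)
      (∫ x, ∫ y, Xk x y * ((fun f : Y → ℂ => fun w => ∫ z, K w z * f z ∂ρ)^[a + 2]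
        (fun z => ∫ v, Xk' z v * ((fun f : Y → ℂ => fun w => ∫ z, K w z * f z ∂ρ)^[b' + 1] (fun u => K u x)) v ∂ρ))
          y ∂ρ ∂ρ) := by
  -- notation
  set κ : (Y → ℂ) → Y → ℂ := fun f w => ∫ z, K w z * f z ∂ρ
  set c : ι → Y → ℂ := fun i x => ∫ z, K x z * (b i : Lp ℂ 2 ρ) z ∂ρ with hc
  set d : ι → Y → ℂ := fun i x => ∫ y, Xk x y * (b i : Lp ℂ 2 ρ) y ∂ρ with hd
  set T : Lp ℂ 2 ρ →L[ℂ] Lp ℂ 2 ρ := (A ^ (a + 2)).comp (Xop'.comp (A ^ (b' + 1))) with hT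
  set Tm : ι × ι → ℂ := fun p => ⟪(b p.2 : Lp ℂ 2 ρ), T (b p.1)⟫_ℂ with hTm
  have hsec : ∀ x, (fun u => K u x) = fun u => conj (K x u) := fun x => funext fun u => hherm u x
  have hsa : IsSelfAdjoint A := isSelfAdjoint_of_ae_hermitianKernel hK hC hherm hA
  have hcm : ∀ i, Measurable (c i) := fun i => (stronglyMeasurable_integral_kernel_mul hK (b i)).measurable
  have hdm : ∀ i, Measurable (d i) := fun i => (stronglyMeasurable_integral_kernel_mul hX (b i)).measurable
  have hlamA : ∀ i, |lam i| ≤ ‖A‖ := StubSpectralTraceC.abs_lam_le_norm hb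
  have hlam2 : Summable fun i => lam i ^ 2 := (hasSum_lam_sq hK hC hA hb).summable
  have hpars := fun x => tsum_norm_sq_integral_kernel_mul_le (μ := ρ) hK hC b x
  have hdb : ∀ i x, ‖d i x‖ ≤ CX * Real.sqrt (ρ.real univ) := fun i x => by
    have h := norm_integral_kernel_mul_le_sqrt hCX ((norm_nonneg _).trans (hCX x x)) (b i : Lp ℂ 2 ρ) x
    rwa [b.orthonormal.norm_eq_one i, mul_one] at h
  -- (A) the inner integral is `⟪t_x, T s_x⟫`
  have hstepA : ∀ x, ∫ y, Xk x y * (κ^[a + 2] (fun z => ∫ v, Xk' z v * (κ^[b' + 1] (fun u => K u x)) v ∂ρ)) y ∂ρ =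
      ⟪(memLp_two_conj_kernel_section hX hCX x).toLp _, T ((memLp_two_conj_kernel_section hK hC x).toLp _)⟫_ℂ := by
    intro x
    obtain ⟨hF, hFcl⟩ := exists_toLp_integral_mul_iterate hX' hCX' hXop' hA
      (memLp_two_conj_kernel_section hK hC x) (b' + 1)
    rw [hsec x, integral_mul_iterate_eq_inner hX hCX hA hF (a + 2) x, hFcl]
    rfl
  -- (B) the matrix of `T`: `⟪bⱼ, T bᵢ⟫ = λⱼ^{a+2} λᵢ^{b+1} ⟪bⱼ, 𝒳' bᵢ⟫`, and its bound
  have hTm_eq : ∀ p : ι × ι, Tm p =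
      (lam p.2 : ℂ) ^ (a + 2) * (lam p.1 : ℂ) ^ (b' + 1) * ⟪(b p.2 : Lp ℂ 2 ρ), Xop' (b p.1)⟫_ℂ := fun p => by
    simp only [hTm, hT, ContinuousLinearMap.comp_apply]
    rw [StubSpectralTraceC.inner_basis_pow_apply hsa hb, StubSpectralTraceC.pow_apply_basis hb, map_smul,
      inner_smul_right]
    ring
  have hTm_le : ∀ p : ι × ι, ‖Tm p‖ ≤ ‖Xop'‖ * ‖A‖ ^ (a + b') * (lam p.2 ^ 2 * |lam p.1|) := fun p => by
    rw [hTm_eq]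
    simp only [norm_mul, norm_pow, Complex.norm_real, Real.norm_eq_abs]
    have h1 : ‖⟪(b p.2 : Lp ℂ 2 ρ), Xop' (b p.1)⟫_ℂ‖ ≤ ‖Xop'‖ := by
      refine (norm_inner_le_norm _ _).trans ?_
      rw [b.orthonormal.norm_eq_one, one_mul]
      calc ‖Xop' (b p.1)‖ ≤ ‖Xop'‖ * ‖(b p.1 : Lp ℂ 2 ρ)‖ := Xop'.le_opNorm _
        _ = ‖Xop'‖ := by rw [b.orthonormal.norm_eq_one, mul_one]
    have h2 : |lam p.2| ^ (a + 2) ≤ ‖A‖ ^ a * lam p.2 ^ 2 := by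
      rw [pow_add, sq_abs]
      exact mul_le_mul_of_nonneg_right (pow_le_pow_left₀ (abs_nonneg _) (hlamA _) a) (sq_nonneg _)
    have h3 : |lam p.1| ^ (b' + 1) ≤ ‖A‖ ^ b' * |lam p.1| := by
      rw [pow_succ]
      exact mul_le_mul_of_nonneg_right (pow_le_pow_left₀ (abs_nonneg _) (hlamA _) b') (abs_nonneg _)
    calc |lam p.2| ^ (a + 2) * |lam p.1| ^ (b' + 1) * ‖⟪(b p.2 : Lp ℂ 2 ρ), Xop' (b p.1)⟫_ℂ‖
        ≤ ‖A‖ ^ a * lam p.2 ^ 2 * (‖A‖ ^ b' * |lam p.1|) * ‖Xop'‖ := by gcongr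
      _ = ‖Xop'‖ * ‖A‖ ^ (a + b') * (lam p.2 ^ 2 * |lam p.1|) := by rw [pow_add]; ring
  -- (C) the dominants `Kc (|cᵢ(x)|² + λᵢ²)/2 · λⱼ²`
  set Kc : ℝ := CX * Real.sqrt (ρ.real univ) * (‖Xop'‖ * ‖A‖ ^ (a + b')) with hKc
  set hy : Y → ι → ℝ := fun x i => (‖c i x‖ ^ 2 + lam i ^ 2) / 2 with hhy
  have hhy_s : ∀ x, Summable (hy x) := fun x => ((hpars x).1.add hlam2).div_const 2
  have hhy0 : ∀ x i, 0 ≤ hy x i := fun x i => by positivity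
  have hbd_s : ∀ x, Summable fun p : ι × ι => Kc * (hy x p.1 * lam p.2 ^ 2) := fun x =>
    ((hhy_s x).mul_of_nonneg hlam2 (hhy0 x) fun j => sq_nonneg _).mul_left Kc
  have hbd : ∀ x (p : ι × ι), ‖conj (c p.1 x) * (d p.2 x * Tm p)‖ ≤ Kc * (hy x p.1 * lam p.2 ^ 2) := fun x p => by
    rw [norm_mul, norm_mul, Complex.norm_conj]
    have hCX0 : 0 ≤ CX * Real.sqrt (ρ.real univ) := (norm_nonneg _).trans (hdb p.2 x)
    have hKc0 : 0 ≤ Kc := mul_nonneg hCX0 (by positivity)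
    have h2 : ‖c p.1 x‖ * |lam p.1| ≤ hy x p.1 := by
      show ‖c p.1 x‖ * |lam p.1| ≤ (‖c p.1 x‖ ^ 2 + lam p.1 ^ 2) / 2
      nlinarith [sq_nonneg (‖c p.1 x‖ - |lam p.1|), sq_abs (lam p.1)]
    calc ‖c p.1 x‖ * (‖d p.2 x‖ * ‖Tm p‖)
        ≤ ‖c p.1 x‖ * (CX * Real.sqrt (ρ.real univ) * (‖Xop'‖ * ‖A‖ ^ (a + b') * (lam p.2 ^ 2 * |lam p.1|))) :=
          mul_le_mul_of_nonneg_left (mul_le_mul (hdb p.2 x) (hTm_le p) (norm_nonneg _) hCX0) (norm_nonneg _)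
      _ = Kc * (‖c p.1 x‖ * |lam p.1| * lam p.2 ^ 2) := by rw [hKc]; ring
      _ ≤ Kc * (hy x p.1 * lam p.2 ^ 2) :=
          mul_le_mul_of_nonneg_left (mul_le_mul_of_nonneg_right h2 (sq_nonneg _)) hKc0
  -- (D) the double expansion `⟪t_x, T s_x⟫ = Σ_{(i,j)} conj cᵢ(x) dⱼ(x) T_{ji}` for every `x`
  have hpt : ∀ x, HasSum (fun p : ι × ι => conj (c p.1 x) * (d p.2 x * Tm p))
      (∫ y, Xk x y * (κ^[a + 2] (fun z => ∫ v, Xk' z v * (κ^[b' + 1] (fun u => K u x)) v ∂ρ)) y ∂ρ) := by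
    intro x
    rw [hstepA x]
    have hs : Summable fun p : ι × ι => conj (c p.1 x) * (d p.2 x * Tm p) :=
      Summable.of_norm_bounded (hbd_s x) (hbd x)
    have h := hasSum_inner_apply_prod b T ((memLp_two_conj_kernel_section hK hC x).toLp _)
      ((memLp_two_conj_kernel_section hX hCX x).toLp _)
    have hcoef : ∀ i, ⟪(b i : Lp ℂ 2 ρ), (memLp_two_conj_kernel_section hK hC x).toLp _⟫_ℂ = conj (c i x) :=
      fun i => by rw [← inner_conj_symm, ← integral_kernel_mul_eq_inner hK hC x (b i)]
    have hcoef' : ∀ j, ⟪(memLp_two_conj_kernel_section hX hCX x).toLp _, (b j : Lp ℂ 2 ρ)⟫_ℂ = d j x :=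
      fun j => (integral_kernel_mul_eq_inner hX hCX x (b j)).symm
    simp only [hcoef, hcoef'] at h
    exact h hs
  -- (E) dominated convergence in `x`
  have key := hasSum_integral_of_dominated_convergence (μ := ρ)
    (F := fun (p : ι × ι) x => conj (c p.1 x) * (d p.2 x * Tm p))
    (f := fun x => ∫ y, Xk x y * (κ^[a + 2] (fun z => ∫ v, Xk' z v * (κ^[b' + 1] (fun u => K u x)) v ∂ρ)) y ∂ρ)
    (fun p x => Kc * (hy x p.1 * lam p.2 ^ 2))
    (fun p => ((Complex.continuous_conj.measurable.comp (hcm p.1)).mul ((hdm p.2).mul_const _)).aestronglyMeasurable)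
    (fun p => Eventually.of_forall fun x => hbd x p) (Eventually.of_forall hbd_s) ?_ (Eventually.of_forall hpt)
  · -- (F) the terms
    refine key.congr_fun fun p => ?_
    have h1 : ∫ x, conj (c p.1 x) * (d p.2 x * Tm p) ∂ρ = Tm p * ((lam p.1 : ℂ) * ⟪(b p.1 : Lp ℂ 2 ρ), Xop (b p.2)⟫_ℂ) := by
      rw [inner_eq_integral_of_ae_kernel hXop, ← integral_const_mul, ← integral_const_mul]
      refine integral_congr_ae ?_
      filter_upwards [StubSpectralTraceC.integral_kernel_mul_basis_ae_eq hA hb p.1] with x hx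
      simp only [hc, hd]
      rw [hx, map_mul, Complex.conj_ofReal]
      ring
    rw [h1, hTm_eq]
    ring
  · -- integrability of the sum of the dominants `Kc (∫ |K(x,·)|² + Σ λ²)/2 · Σ λ²`
    have hfun : (fun x => ∑' p : ι × ι, Kc * (hy x p.1 * lam p.2 ^ 2)) =
        fun x => Kc * ((∫ z, ‖K x z‖ ^ 2 ∂ρ + ∑' i, lam i ^ 2) / 2 * ∑' j, lam j ^ 2) := by
      funext x
      rw [tsum_mul_left, ← (hhy_s x).tsum_mul_tsum hlam2 ((hhy_s x).mul_of_nonneg hlam2 (hhy0 x)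
        fun j => sq_nonneg _)]
      simp only [hhy]
      rw [tsum_div_const, (hpars x).1.tsum_add hlam2, (hpars x).2.1]
    rw [hfun]
    exact ((((integrable_integral_norm_sq hK hC).add (integrable_const _)).div_const 2).mul_const _).const_mul _

end StubSpectralTraceInsertC

/-- **Sub-goal E1a of line `twisted_trace_transfer` (registered stub `stub_spectralTraceInsertC`; complex Hermitian ports
of `Literature.Analysis.OperatorTheory.hasSum_integral_iterate_insert_one` and `hasSum_integral_iterate_insert_two`):
trace formulas with one and two BOND insertions.**  For a bounded, strongly measurable, HERMITIAN kernel `K` on a finite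
measure space with bounded operator `A` (a.e. kernel formula), a countable Hilbert basis `b` of eigenvectors with real
eigenvalues `λᵢ`, and bounded bond kernels `X, X'` with `L²` operators `𝒳, 𝒳'`:
`∫∫ X(x,y) (κ^[M+1] K(·,x))(y) = Σᵢ λᵢ^{M+2} ⟪bᵢ, 𝒳 bᵢ⟫` and
`∫∫ X(x,y) (κ^[a+2] (z ↦ ∫ X'(z,v) (κ^[b+1] K(·,x))(v)))(y) = Σ_{(i,j)} λⱼ^{a+2} λᵢ^{b+2} ⟪bᵢ, 𝒳 bⱼ⟫ ⟪bⱼ, 𝒳' bᵢ⟫`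
(`Tr(𝒳 A^{M+2})`, `Tr(𝒳 A^{a+2} 𝒳' A^{b+2})` without a trace class; `κ f = ∫ K(·,z) f(z) dρ(z)`; NO sign hypothesis
on `λᵢ`: `StubSpectralTraceInsertC.hasSum_insert_one`, `StubSpectralTraceInsertC.hasSum_insert_two`). [folklore] -/
theorem stub_spectralTraceInsertC : ∀ (Y : Type) [MeasurableSpace Y] (ρ : Measure Y) [IsFiniteMeasure ρ]
    (K : Y → Y → ℂ) (C : ℝ), StronglyMeasurable (Function.uncurry K) → (∀ x y, ‖K x y‖ ≤ C) →
    (∀ x y, K x y = (starRingEnd ℂ) (K y x)) →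
    ∀ A : Lp ℂ 2 ρ →L[ℂ] Lp ℂ 2 ρ, (∀ φ : Lp ℂ 2 ρ, (A φ : Y → ℂ) =ᵐ[ρ] fun x => ∫ y, K x y * φ y ∂ρ) →
    ∀ (ι : Type) [Countable ι] (b : HilbertBasis ι ℂ (Lp ℂ 2 ρ)) (lam : ι → ℝ),
      (∀ i, A (b i) = (lam i : ℂ) • (b i : Lp ℂ 2 ρ)) →
    ∀ (Xk : Y → Y → ℂ) (CX : ℝ), StronglyMeasurable (Function.uncurry Xk) → (∀ x y, ‖Xk x y‖ ≤ CX) →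
    ∀ Xop : Lp ℂ 2 ρ →L[ℂ] Lp ℂ 2 ρ, (∀ φ : Lp ℂ 2 ρ, (Xop φ : Y → ℂ) =ᵐ[ρ] fun x => ∫ y, Xk x y * φ y ∂ρ) →
    ∀ (Xk' : Y → Y → ℂ) (CX' : ℝ), StronglyMeasurable (Function.uncurry Xk') → (∀ x y, ‖Xk' x y‖ ≤ CX') →
    ∀ Xop' : Lp ℂ 2 ρ →L[ℂ] Lp ℂ 2 ρ, (∀ φ : Lp ℂ 2 ρ, (Xop' φ : Y → ℂ) =ᵐ[ρ] fun x => ∫ y, Xk' x y * φ y ∂ρ) →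
    (∀ M : ℕ, HasSum (fun i => (lam i : ℂ) ^ (M + 2) * ⟪(b i : Lp ℂ 2 ρ), Xop (b i)⟫_ℂ)
      (∫ x, ∫ y, Xk x y * ((fun f : Y → ℂ => fun w => ∫ z, K w z * f z ∂ρ)^[M + 1] (fun z => K z x)) y ∂ρ ∂ρ)) ∧
    (∀ a b' : ℕ, HasSum (fun p : ι × ι => (lam p.2 : ℂ) ^ (a + 2) * (lam p.1 : ℂ) ^ (b' + 2) *
        ⟪(b p.1 : Lp ℂ 2 ρ), Xop (b p.2)⟫_ℂ * ⟪(b p.2 : Lp ℂ 2 ρ), Xop' (b p.1)⟫_ℂ)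
      (∫ x, ∫ y, Xk x y * ((fun f : Y → ℂ => fun w => ∫ z, K w z * f z ∂ρ)^[a + 2]
        (fun z => ∫ v, Xk' z v * ((fun f : Y → ℂ => fun w => ∫ z, K w z * f z ∂ρ)^[b' + 1] (fun u => K u x)) v ∂ρ))
          y ∂ρ ∂ρ)) := by
  intro Y _ ρ _ K C hK hC hherm A hA ι _ b lam hb Xk CX hX hCX Xop hXop Xk' CX' hX' hCX' Xop' hXop'
  exact ⟨fun M => StubSpectralTraceInsertC.hasSum_insert_one hK hC hherm hA hb hX hCX hXop M,
    fun a b' => StubSpectralTraceInsertC.hasSum_insert_two hK hC hherm hA hb hX hCX hXop hX' hCX' hXop' a b'⟩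

end Summit.QuantumFields.QCD.Cruxes.StableActionBridge.TwistedTraceTransfer

end
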